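import Literature.Analysis.FluidPDE.PineauVicolOneSliceGradient
import Literature.Analysis.FluidPDE.PineauVicolLocalPressureMass
import HarnessLib

/-!
# Lemma 7.1 of Pineau–Vicol in physical variables: derivative bounds for Type I classical solutions

Analysis/FluidPDE support file (all results proved; no named facts) in the discharge programme of
`Literature.Analysis.FluidPDE.pineauVicol2026_rdss_liouville` (B. Pineau, V. Vicol,
arXiv:2607.09619 (2026), Thm. 1.7). Lemma 7.1 (p. 23–24) derives, for the self-similar profile
of a Type I backward solution, bounds on all space derivatives with constants depending on
`C_{U,0}` only, by rescaling to unit parabolic cylinders and quantitative interior regularity.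
Here, in physical variables (`exists_forall_iteratedFDeriv_le_of_typeI`): for every `n`, `C₀`
there is `K(n, C₀)` with `‖Dⁿₓu(t,·)(x)‖ ≤ K · max{|x|, √(−t)}^{−(n+1)}` for every classical
solution on `(−∞, 0)` with `|u(x,t)| ≤ C₀/(|x| + √(−t))` (the source's (7.2) after the
self-similar change of variables). Ingredients:

* `exists_forall_iteratedFDeriv_le_of_bounded`: the `n`-th order version of the tree's
  `exists_forall_fderiv_le_of_bounded` (quantitative Serrin on `Q(z, c)` via
  `NSBootstrap.exists_smooth_holder_rep_norm`; the source's pressure-free Lemma 9.1 is replaced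
  by the pressure route);
* `gradient_pressure_eq_of_typeI_vertex`: the pressure of a Type I classical solution with any
  parabolic vertex is the potential `Q[u(t)]` up to a function of time
  (`PineauVicolPressureIdentification`), used for the zoomed solution — hence the need for the
  backward extension to `(−∞, 0)` (footnote 21);
* the zoom `c = max{|x|, √(−t−δ)}/16`, `δ = −t/2048` onto the unit cylinder below the point:
  there `|v| ≤ C₀` (footnote 22) and the zoomed slices are near-singular profiles with vertex on
  the sphere of radius `16` or regular, so `PineauVicolLocalPressureMass` bounds the cylinder
  mass of the gauged pressure (`lintegral_ball_rpow_three_halves_le`, Tonelli);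
* the gauge `h(s) = q(πs,0) − Q[v(πs)](0)` is measurable and bounded
  (`measurable_pressurePotential_clamp`, `exists_bound_pressurePotential_decay`);
* `norm_iteratedFDeriv_unzoom_le` to return to `u`.

## References

* B. Pineau, V. Vicol, arXiv:2607.09619 (2026), Lemma 7.1 and its proof, footnotes 21, 22;
  Lemma 9.1. [PineauVicol2026]
* J. Serrin, Arch. Rational Mech. Anal. 9 (1962); G. Seregin, V. Šverák (2009), §2 (the
  quantitative interior regularity as vendored in `NSBootstrapHigherHolder`).
-/

noncomputable section

open MeasureTheory Set Function Filter Metric TopologicalSpace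
open _root_.Topology
open scoped ENNReal NNReal InnerProductSpace RealInnerProductSpace Laplacian ContDiff

namespace Literature.Analysis.FluidPDE

namespace PineauVicol2026

section Serrin

-- nested operator types
set_option maxSynthPendingDepth 3

/-- **Serrin-type bounds of all orders for bounded classical solutions with an `L^{3/2}`
pressure, quantitative** (the `n`-th order version of
`exists_forall_fderiv_le_of_bounded`). For every `n`, velocity bound `A` and pressure bound `P`
there is `K = K(n, A, P)` such that: if `(u, p)` is a classical solution (`ν = 1`, `f = 0`) on
the open cylinder `Q(z, c)` whose slices are `Cⁿ` (globally, as for classical solutions on a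
time set), with `|u| ≤ A/c` there and `c⁻² ∫∫_{Q(z,c)} |p − h(t)|^{3/2} ≤ P` for some locally
integrable `h`, then `|Dⁿu| ≤ K/c^{n+1}` on `Q(z, c/2)` (parabolic zoom, pressure gauge, and
the tree's quantitative bootstrap `NSBootstrap.exists_smooth_holder_rep_norm`, all orders).
This is the interior estimate invoked in Lemma 7.1 of the source (there in the pressure-free
form of Lemma 9.1 / [16, Lemma A.2]). [cite: PineauVicol2026, Lemma 7.1 (proof, p. 24) and Lemma 9.1] -/
theorem exists_forall_iteratedFDeriv_le_of_bounded (n : ℕ) (A : ℝ) (P : ℝ≥0) :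
    ∃ K : ℝ, 0 ≤ K ∧ ∀ (u : ℝ → (EuclideanSpace ℝ (Fin 3)) → (EuclideanSpace ℝ (Fin 3))) (p : ℝ → (EuclideanSpace ℝ (Fin 3)) → ℝ) (h : ℝ → ℝ) (z : ℝ × (EuclideanSpace ℝ (Fin 3))) (c : ℝ),
      0 < c →
      IsClassicalNSSolutionOnRegion (parabolicCylinder c z) 1 0 u p →
      (∀ w ∈ parabolicCylinder c z, ContDiff ℝ n (u w.1)) →
      (∀ w ∈ parabolicCylinder c z, ‖u w.1 w.2‖ ≤ A / c) →
      LocallyIntegrableOn (fun w : ℝ × (EuclideanSpace ℝ (Fin 3)) => h w.1) (parabolicCylinder c z) volume →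
      (∫⁻ w in parabolicCylinder c z, ‖p w.1 w.2 - h w.1‖ₑ ^ (3 / 2 : ℝ) ≤
        ENNReal.ofReal (c ^ 2) * P) →
      ∀ w ∈ parabolicCylinder (c / 2) z, ‖iteratedFDeriv ℝ n (u w.1) w.2‖ ≤ K / c ^ (n + 1) := by
  obtain ⟨Kf, Cf, αf, hαf, hnorm⟩ := NSBootstrap.exists_smooth_holder_rep_norm 1 A P
  refine ⟨Kf n (1 / 2), (Kf n (1 / 2)).coe_nonneg, ?_⟩
  intro u p h z c hc hreg hsl hbd hh hP w hw
  have hc2 : 0 < c ^ 2 := by positivity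
  set Q : Set (ℝ × (EuclideanSpace ℝ (Fin 3))) := parabolicCylinder c z with hQ_def
  have hQo : IsOpen Q := isOpen_parabolicCylinder c z
  set Φ := stAffine (c ^ 2) c z.1 z.2 with hΦ_def
  have hpre : Φ ⁻¹' Q = parabolicCylinder 1 (0 : ℝ × (EuclideanSpace ℝ (Fin 3))) :=
    stAffine_sq_preimage_parabolicCylinder_self hc z
  -- the zoomed classical solution on `Q(0, 1)`
  set v : ℝ → (EuclideanSpace ℝ (Fin 3)) → (EuclideanSpace ℝ (Fin 3)) := c • stPull (c ^ 2) c z.1 z.2 u with hv_def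
  set ph : ℝ → (EuclideanSpace ℝ (Fin 3)) → ℝ := fun t x => p t x - h t with hph_def
  set q : ℝ → (EuclideanSpace ℝ (Fin 3)) → ℝ := c ^ 2 • stPull (c ^ 2) c z.1 z.2 p with hq_def
  set hz : ℝ → ℝ := fun s => c ^ 2 * h (z.1 + c ^ 2 * s) with hhz_def
  have hcl : IsClassicalNSSolutionOnRegion (parabolicCylinder 1 (0 : ℝ × (EuclideanSpace ℝ (Fin 3)))) 1 0 v q := by
    have h1 := hreg.nsRescale_translate_of_isOpen hQo hc z.1 z.2
    have ef : (c ^ 2 * c) • stPull (c ^ 2) c z.1 z.2 (0 : ℝ → (EuclideanSpace ℝ (Fin 3)) → (EuclideanSpace ℝ (Fin 3))) = 0 := by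
      funext s y; simp [stPull_apply]
    rw [ef, hpre] at h1
    exact h1
  have hdist : IsDistributionalNSSolutionOn (parabolicCylinderOpens 1 (0 : ℝ × (EuclideanSpace ℝ (Fin 3)))) 1 0 v
      (fun s y => q s y - hz s) := by
    have hd := hcl.isDistributionalNSSolutionOn (isOpen_parabolicCylinder 1 0)
      (Q := parabolicCylinderOpens 1 (0 : ℝ × (EuclideanSpace ℝ (Fin 3)))) Subset.rfl
    refine hd.sub_timeFun ?_
    -- `s ↦ c² h(t + c² s)` is locally integrable on `Q(0,1)` (transport along the zoom)
    have hF := (hh.comp_stAffine hc2 hc z.1 z.2).smul (c ^ 2)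
    have e : (c ^ 2) • ((fun w : ℝ × (EuclideanSpace ℝ (Fin 3)) => h w.1) ∘ stAffine (c ^ 2) c z.1 z.2) =
        fun w : ℝ × (EuclideanSpace ℝ (Fin 3)) => hz w.1 := by
      funext w
      simp [hhz_def, stAffine, smul_eq_mul]
    rw [e, ← hΦ_def, hpre] at hF
    exact hF
  -- the velocity bound `|v| ≤ A` on `Q(0, 1)`
  have hbd' : ∀ᵐ w ∂(volume.restrict (parabolicCylinder 1 (0 : ℝ × (EuclideanSpace ℝ (Fin 3))))), ‖v w.1 w.2‖ ≤ A := by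
    filter_upwards [ae_restrict_mem (isOpen_parabolicCylinder 1 0).measurableSet] with w hw'
    have hΦw : Φ w ∈ Q := by rw [← mem_preimage, hpre]; exact hw'
    have hb := hbd (Φ w) hΦw
    have e : v w.1 w.2 = c • u (Φ w).1 (Φ w).2 := rfl
    rw [e, norm_smul, Real.norm_of_nonneg hc.le]
    calc c * ‖u (Φ w).1 (Φ w).2‖ ≤ c * (A / c) := by gcongr
      _ = A := by field_simp
  -- the pressure bound `∫∫_{Q(0,1)} |q - hz|^{3/2} ≤ P`
  have hP' : ∫⁻ w in parabolicCylinder 1 (0 : ℝ × (EuclideanSpace ℝ (Fin 3))), ‖q w.1 w.2 - hz w.1‖ₑ ^ (3 / 2 : ℝ) ≤ P := by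
    have e : (fun w : ℝ × (EuclideanSpace ℝ (Fin 3)) => ‖q w.1 w.2 - hz w.1‖ₑ ^ (3 / 2 : ℝ)) =
        fun w => ‖(c ^ 2 • stPull (c ^ 2) c z.1 z.2 ph) w.1 w.2‖ₑ ^ (3 / 2 : ℝ) := by
      funext w
      congr 2
      simp only [hq_def, hph_def, hhz_def, Pi.smul_apply, stPull_apply, smul_eq_mul]
      ring
    rw [e, ← hpre, hΦ_def, setLIntegral_enorm_rpow_stRescale hc2 hc z.1 z.2 (c ^ 2) ph Q
      (r := 3 / 2) (by norm_num), finrank_euclideanSpace_fin]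
    have e0 : (c ^ 2 : ℝ) ^ (3 / 2 : ℝ) = c ^ 3 := by
      rw [show (c ^ 2 : ℝ) = c ^ (2 : ℝ) by norm_cast, ← Real.rpow_mul hc.le,
        show (2 : ℝ) * (3 / 2) = ((3 : ℕ) : ℝ) by norm_num, Real.rpow_natCast]
    have e1 : ‖(c ^ 2 : ℝ)‖ₑ ^ (3 / 2 : ℝ) * ENNReal.ofReal (c ^ 2 * c ^ 3)⁻¹ *
        ENNReal.ofReal (c ^ 2) = 1 := by
      have er : c ^ 3 * (c ^ 2 * c ^ 3)⁻¹ * c ^ 2 = 1 := by field_simp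
      rw [Real.enorm_eq_ofReal hc2.le, ENNReal.ofReal_rpow_of_nonneg hc2.le (by norm_num), e0,
        ← ENNReal.ofReal_mul (pow_nonneg hc.le 3), ← ENNReal.ofReal_mul (by positivity), er,
        ENNReal.ofReal_one]
    calc ‖(c ^ 2 : ℝ)‖ₑ ^ (3 / 2 : ℝ) * ENNReal.ofReal (c ^ 2 * c ^ 3)⁻¹ *
          ∫⁻ w in Q, ‖ph w.1 w.2‖ₑ ^ (3 / 2 : ℝ)
        ≤ ‖(c ^ 2 : ℝ)‖ₑ ^ (3 / 2 : ℝ) * ENNReal.ofReal (c ^ 2 * c ^ 3)⁻¹ *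
            (ENNReal.ofReal (c ^ 2) * P) := by gcongr
      _ = P := by rw [← mul_assoc, e1, one_mul]
  -- the quantitative Serrin theorem
  obtain ⟨V, hVae, -, hVn⟩ := hnorm v _ hdist hbd' hP'
  obtain ⟨hH0, -⟩ := hVn 0 (3 / 4) ⟨by norm_num, by norm_num⟩
  obtain ⟨-, hK1⟩ := hVn n (1 / 2) ⟨by norm_num, by norm_num⟩
  -- `V = v` on `Q(0, 3/4)` (both continuous)
  have hVc : ContinuousOn (uncurry V) (parabolicCylinder (3 / 4) (0 : ℝ × (EuclideanSpace ℝ (Fin 3)))) := by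
    have h1 := hH0.continuousOn (hαf 0 (3 / 4) ⟨by norm_num, by norm_num⟩)
    have h2 : ContinuousOn (fun w : ℝ × (EuclideanSpace ℝ (Fin 3)) => (iteratedFDeriv ℝ 0 (V w.1) w.2) (fun _ => 0))
        (parabolicCylinder (3 / 4) (0 : ℝ × (EuclideanSpace ℝ (Fin 3)))) :=
      (continuous_eval_const (fun _ : Fin 0 => (0 : (EuclideanSpace ℝ (Fin 3))))).comp_continuousOn h1
    refine h2.congr fun w _ => ?_
    simp only [iteratedFDeriv_zero_apply]
    rfl
  have hvc : ContinuousOn (uncurry v) (parabolicCylinder 1 (0 : ℝ × (EuclideanSpace ℝ (Fin 3)))) := by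
    have e : uncurry v = c • (uncurry u ∘ Φ) := by funext w; rfl
    rw [e]
    refine ContinuousOn.const_smul (hreg.smooth_velocity.continuousOn.comp
      (continuous_stAffine _ _ _ _).continuousOn fun w hw' => ?_) c
    have hw'' : w ∈ Φ ⁻¹' Q := by rw [hpre]; exact hw'
    exact hw''
  have hsub34 : parabolicCylinder (3 / 4) (0 : ℝ × (EuclideanSpace ℝ (Fin 3))) ⊆ parabolicCylinder 1 0 :=
    prod_mono (Ioo_subset_Ioo (by norm_num) le_rfl) (ball_subset_ball (by norm_num))
  have hsub12 : parabolicCylinder (1 / 2) (0 : ℝ × (EuclideanSpace ℝ (Fin 3))) ⊆ parabolicCylinder (3 / 4) 0 :=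
    prod_mono (Ioo_subset_Ioo (by norm_num) le_rfl) (ball_subset_ball (by norm_num))
  have hEq : EqOn (uncurry v) (uncurry V) (parabolicCylinder (3 / 4) (0 : ℝ × (EuclideanSpace ℝ (Fin 3)))) :=
    Measure.eqOn_open_of_ae_eq (ae_restrict_of_ae_restrict_of_subset hsub34 hVae)
      (isOpen_parabolicCylinder _ _) (hvc.mono hsub34) hVc
  -- the `n`-th derivative bound for `v` on `Q(0, 1/2)`
  have hgradv : ∀ w' ∈ parabolicCylinder (1 / 2) (0 : ℝ × (EuclideanSpace ℝ (Fin 3))),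
      ‖iteratedFDeriv ℝ n (v w'.1) w'.2‖ ≤ Kf n (1 / 2) := by
    intro w' hw'
    have hev : v w'.1 =ᶠ[𝓝 w'.2] V w'.1 := by
      have hw34 : w' ∈ parabolicCylinder (3 / 4) (0 : ℝ × (EuclideanSpace ℝ (Fin 3))) := hsub12 hw'
      rw [mem_parabolicCylinder] at hw34
      have hopen : IsOpen {y : (EuclideanSpace ℝ (Fin 3)) | dist y (0 : ℝ × (EuclideanSpace ℝ (Fin 3))).2 < 3 / 4} :=
        isOpen_lt (continuous_id.dist continuous_const) continuous_const
      filter_upwards [hopen.mem_nhds hw34.2] with y hy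
      have hmem : ((w'.1, y) : ℝ × (EuclideanSpace ℝ (Fin 3))) ∈ parabolicCylinder (3 / 4) (0 : ℝ × (EuclideanSpace ℝ (Fin 3))) :=
        mem_parabolicCylinder.2 ⟨hw34.1, hy⟩
      exact hEq hmem
    rw [(hev.iteratedFDeriv ℝ n).eq_of_nhds]
    exact hK1 w' hw'
  -- unscale
  set w' : ℝ × (EuclideanSpace ℝ (Fin 3)) := ((w.1 - z.1) / c ^ 2, c⁻¹ • (w.2 - z.2)) with hw'_def
  have hw'mem : w' ∈ parabolicCylinder (1 / 2) (0 : ℝ × (EuclideanSpace ℝ (Fin 3))) := by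
    have : w ∈ parabolicCylinder (c * (1 / 2)) z := by rwa [mul_one_div]
    exact inv_zoom_mem_parabolicCylinder hc this
  have hw0 : w ∈ parabolicCylinder c z := parabolicCylinder_mono (by positivity) (by linarith) z hw
  -- express the slice of `u` through the slice of `v`: `u(w.1, x) = c⁻¹ v(w'.1, c⁻¹(x - z.2))`
  set L : (EuclideanSpace ℝ (Fin 3)) →L[ℝ] (EuclideanSpace ℝ (Fin 3)) := c⁻¹ • ContinuousLinearMap.id ℝ _ with hL
  have hLapp : ∀ y, L y = c⁻¹ • y := fun y => by simp [hL]
  have ht1 : z.1 + c ^ 2 * w'.1 = w.1 := by simp only [hw'_def]; field_simp; ring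
  have hslice : u w.1 = c⁻¹ • fun x => ((v w'.1) ∘ L) (x - z.2) := by
    funext x
    have hx2 : z.2 + c • (c⁻¹ • (x - z.2)) = x := by
      rw [smul_smul, mul_inv_cancel₀ hc.ne', one_smul, add_sub_cancel]
    simp only [Pi.smul_apply, Function.comp_apply, hLapp, hv_def, stPull_apply, ht1, hx2]
    rw [smul_smul, inv_mul_cancel₀ hc.ne', one_smul]
  have hvs : ContDiff ℝ n (v w'.1) := by
    have e : v w'.1 = fun y => c • u w.1 (z.2 + c • y) := by
      funext y
      simp only [hv_def, Pi.smul_apply, stPull_apply, ht1]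
    rw [e]
    exact ((hsl w hw0).comp (contDiff_const.add (contDiff_id.const_smul c))).const_smul c
  have key := hgradv w' hw'mem
  have hLn : ‖L‖ ≤ c⁻¹ := by
    rw [hL]; refine (norm_smul_le _ _).trans ?_
    rw [Real.norm_of_nonneg (inv_nonneg.2 hc.le)]
    exact mul_le_of_le_one_right (inv_nonneg.2 hc.le) ContinuousLinearMap.norm_id_le
  have hcomp : ContDiff ℝ n ((v w'.1) ∘ L) := hvs.comp L.contDiff
  have hcomp' : ContDiff ℝ n fun x => ((v w'.1) ∘ L) (x - z.2) := hcomp.comp (contDiff_id.sub contDiff_const)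
  have e1 : iteratedFDeriv ℝ n (u w.1) w.2 =
      c⁻¹ • (iteratedFDeriv ℝ n (v w'.1) (L (w.2 - z.2))).compContinuousLinearMap fun _ => L := by
    rw [hslice, iteratedFDeriv_const_smul_apply hcomp'.contDiffAt, iteratedFDeriv_comp_sub,
      L.iteratedFDeriv_comp_right hvs _ le_rfl]
  have hLw : L (w.2 - z.2) = w'.2 := by simp [hL, hw'_def]
  rw [e1, hLw, norm_smul, Real.norm_of_nonneg (inv_nonneg.2 hc.le)]
  have hprod : ‖(iteratedFDeriv ℝ n (v w'.1) w'.2).compContinuousLinearMap (fun _ => L)‖ ≤ Kf n (1 / 2) * c⁻¹ ^ n := by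
    refine (ContinuousMultilinearMap.norm_compContinuousLinearMap_le _ _).trans ?_
    rw [Finset.prod_const, Finset.card_univ, Fintype.card_fin]
    exact mul_le_mul key (pow_le_pow_left₀ (norm_nonneg _) hLn n) (by positivity) (Kf n (1 / 2)).coe_nonneg
  have hfin : c⁻¹ * (Kf n (1 / 2) * c⁻¹ ^ n) = Kf n (1 / 2) / c ^ (n + 1) := by
    have hcn : c ^ (n + 1) ≠ 0 := pow_ne_zero _ hc.ne'
    rw [eq_div_iff hcn, pow_succ]
    calc c⁻¹ * (↑(Kf n (1 / 2)) * c⁻¹ ^ n) * (c ^ n * c)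
        = ↑(Kf n (1 / 2)) * (c⁻¹ ^ n * c ^ n) * (c⁻¹ * c) := by ring
      _ = ↑(Kf n (1 / 2)) := by rw [inv_pow, inv_mul_cancel₀ (pow_ne_zero _ hc.ne'), inv_mul_cancel₀ hc.ne']; ring
  calc c⁻¹ * ‖(iteratedFDeriv ℝ n (v w'.1) w'.2).compContinuousLinearMap fun _ => L‖ ≤ c⁻¹ * (Kf n (1 / 2) * c⁻¹ ^ n) :=
        mul_le_mul_of_nonneg_left hprod (inv_nonneg.2 hc.le)
    _ = Kf n (1 / 2) / c ^ (n + 1) := hfin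

end Serrin

section Identification

open scoped Topology

/-- Local notation for physical space `ℝ³ = EuclideanSpace ℝ (Fin 3)`. -/
local notation "ℝ³" => EuclideanSpace ℝ (Fin 3)

/-- A Type I profile centred at `(x₀, s₀ > 0)` lies in the decay class centred at the origin
(qualitative constant): `|v(y)| ≤ C₀/(|y − x₀| + s₀) ⇒ (1+|y|)|v(y)| ≤ C₀(1+|x₀|+s₀)/min(s₀,1)`.
[folklore] -/
theorem decay_of_profile {v : ℝ³ → ℝ³} {C₀ s₀ : ℝ} {x₀ : ℝ³} (hs₀ : 0 < s₀)
    (hv : ∀ y, ‖v y‖ ≤ C₀ / (‖y - x₀‖ + s₀)) (y : ℝ³) :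
    ‖v y‖ ≤ C₀ * (1 + ‖x₀‖ + s₀) / min s₀ 1 / (1 + ‖y‖) := by
  have hC : 0 ≤ C₀ := by
    have := (norm_nonneg _).trans (hv x₀)
    rw [sub_self, norm_zero, zero_add] at this
    exact (div_nonneg_iff.1 this).elim (fun h => h.1) fun h => absurd h.2 (not_le.2 hs₀)
  have hm0 : 0 < min s₀ 1 := lt_min hs₀ one_pos
  have hden : 0 < ‖y - x₀‖ + s₀ := by positivity
  -- `min(s₀,1) (1 + |y|) ≤ (1 + |x₀| + s₀)(|y − x₀| + s₀)`
  have hkey : min s₀ 1 * (1 + ‖y‖) ≤ (1 + ‖x₀‖ + s₀) * (‖y - x₀‖ + s₀) := by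
    have h1 : ‖y‖ ≤ ‖x₀‖ + ‖y - x₀‖ := by
      have := norm_add_le x₀ (y - x₀); rwa [add_sub_cancel] at this
    have h2 : min s₀ 1 ≤ s₀ := min_le_left _ _
    have h3 : min s₀ 1 ≤ 1 := min_le_right _ _
    have h4 : min s₀ 1 * ‖y‖ ≤ ‖x₀‖ * s₀ + ‖y - x₀‖ * 1 + ‖y - x₀‖ * ‖x₀‖ + ‖y - x₀‖ * s₀ - ‖y - x₀‖ * s₀ +
        (‖x₀‖ * ‖y - x₀‖ - ‖x₀‖ * ‖y - x₀‖) + 0 := by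
      nlinarith [norm_nonneg (y - x₀), norm_nonneg x₀, norm_nonneg y, hm0.le,
        mul_le_mul_of_nonneg_right h1 hm0.le]
    nlinarith [norm_nonneg (y - x₀), norm_nonneg x₀, norm_nonneg y, hm0.le, hs₀.le,
      mul_le_mul_of_nonneg_right h1 hm0.le, mul_nonneg (norm_nonneg x₀) (norm_nonneg (y - x₀))]
  rw [div_div, le_div_iff₀ (by positivity)]
  calc ‖v y‖ * (min s₀ 1 * (1 + ‖y‖)) ≤ C₀ / (‖y - x₀‖ + s₀) * ((1 + ‖x₀‖ + s₀) * (‖y - x₀‖ + s₀)) :=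
        mul_le_mul (hv y) hkey (by positivity) (by positivity)
    _ = C₀ * (1 + ‖x₀‖ + s₀) := by field_simp

/-- **`∇p(t) = ∇Q[u(t)]` for classical Type I solutions with an arbitrary parabolic vertex.**
For a classical solution of Navier–Stokes (`ν = 1`, `f = 0`) on `(−∞, T)` with
`|u(x,t)| ≤ C₀/(|x − x₀| + √(T − t))`, `∇p(t) = ∇Q[u(t)]` for every `t < T` (the window
`[2t − T, (t+T)/2]` hmm — we use `[t − (T − t), (t + T)/2]` — translated to `[0, ·]`, the profile
put in the decay class by `decay_of_profile`, and
`gradient_pressure_eq_gradient_pressurePotential_decay`). [cite: PineauVicol2026, Lemma 7.1 (proof, p. 24)] -/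
theorem gradient_pressure_eq_of_typeI_vertex {u : ℝ → ℝ³ → ℝ³} {p : ℝ → ℝ³ → ℝ} {C₀ T : ℝ} {x₀ : ℝ³}
    (hsol : FluidPDE.IsClassicalNSSolutionOn (Iio T) 1 0 u p)
    (hI : ∀ t ∈ Iio T, ∀ x, ‖u t x‖ ≤ C₀ / (‖x - x₀‖ + Real.sqrt (T - t))) {t : ℝ}
    (ht : t < T) (x : ℝ³) :
    gradient (p t) x = gradient (pressurePotential (u t)) x := by
  -- the window `[t₁, t₂] = [t − (T − t), (t + T)/2]`
  set t₁ : ℝ := t - (T - t) with ht₁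
  set t₂ : ℝ := (t + T) / 2 with ht₂
  have h2 : t₁ < t := by rw [ht₁]; linarith
  have h3 : t < t₂ := by rw [ht₂]; linarith
  have h4 : t₂ < T := by rw [ht₂]; linarith
  set S : ℝ := t₂ - t₁ with hS
  have hS0 : 0 < S := by rw [hS]; linarith
  have hsol' : FluidPDE.IsClassicalNSSolutionOn (Icc 0 S) 1 0 (fun s => u (s + t₁)) (fun s => p (s + t₁)) := by
    have h := hsol.comp_add_right t₁
    refine h.mono (fun s hs => ?_) (uniqueDiffOn_Icc hS0)
    simp only [mem_preimage, mem_Iio]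
    linarith [hs.2]
  -- the decay constant on the window
  set δ : ℝ := Real.sqrt (T - t₂) with hδ
  have hδ0 : 0 < δ := Real.sqrt_pos.2 (by linarith)
  have hC₀ : 0 ≤ C₀ := by
    have := hI t ht x₀
    rw [sub_self, norm_zero, zero_add] at this
    have hpos : 0 < Real.sqrt (T - t) := Real.sqrt_pos.2 (by linarith)
    exact (div_nonneg_iff.1 ((norm_nonneg _).trans this)).elim (fun h => h.1) fun h => absurd h.2 (not_le.2 hpos)
  set C : ℝ := C₀ * (1 + ‖x₀‖ + δ) / min δ 1 with hC
  have hCnn : 0 ≤ C := by rw [hC]; positivity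
  have hdec : ∀ s ∈ Icc 0 S, ∀ y, ‖u (s + t₁) y‖ ≤ C / (1 + ‖y‖) := by
    intro s hs y
    have hτ : s + t₁ ∈ Iio T := by simp only [mem_Iio]; linarith [hs.2]
    have hτ2 : T - t₂ ≤ T - (s + t₁) := by linarith [hs.2]
    have hsq : δ ≤ Real.sqrt (T - (s + t₁)) := Real.sqrt_le_sqrt hτ2
    -- weaken the profile to the scale `δ`, then `decay_of_profile`
    have hprof : ∀ y, ‖u (s + t₁) y‖ ≤ C₀ / (‖y - x₀‖ + δ) := fun y =>
      (hI _ hτ y).trans (div_le_div_of_nonneg_left hC₀ (by positivity) (by linarith))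
    exact decay_of_profile hδ0 hprof y
  have key := gradient_pressure_eq_gradient_pressurePotential_decay zero_le_one hsol' hCnn hdec
    (t := t - t₁) ⟨by linarith, by rw [hS]; linarith⟩ x
  simpa only [sub_add_cancel] using key

end Identification

section TypeIRegularity

open scoped Topology

/-- Local notation for physical space `ℝ³ = EuclideanSpace ℝ (Fin 3)`. -/
local notation "ℝ³" => EuclideanSpace ℝ (Fin 3)

-- nested operator types
set_option maxSynthPendingDepth 3

/-- **Unzooming iterated derivatives**: for `f(ξ) = c⁻¹ g(c⁻¹(ξ − x₀))` with `g ∈ Cⁿ`, `c > 0`,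
`‖Dⁿf(ξ)‖ ≤ c^{−(n+1)} ‖Dⁿg(c⁻¹(ξ − x₀))‖`. [folklore] -/
theorem norm_iteratedFDeriv_unzoom_le {F : Type*} [NormedAddCommGroup F] [NormedSpace ℝ F]
    {g : ℝ³ → F} {n : ℕ} (hg : ContDiff ℝ n g) {c : ℝ} (hc : 0 < c) (x₀ ξ : ℝ³) :
    ‖iteratedFDeriv ℝ n (fun ξ => c⁻¹ • g (c⁻¹ • (ξ - x₀))) ξ‖ ≤
      c⁻¹ ^ (n + 1) * ‖iteratedFDeriv ℝ n g (c⁻¹ • (ξ - x₀))‖ := by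
  set L : ℝ³ →L[ℝ] ℝ³ := c⁻¹ • ContinuousLinearMap.id ℝ ℝ³ with hL
  have hLn : ‖L‖ ≤ c⁻¹ := by
    rw [hL]; refine (norm_smul_le _ _).trans ?_
    rw [Real.norm_of_nonneg (inv_nonneg.2 hc.le)]
    exact mul_le_of_le_one_right (inv_nonneg.2 hc.le) ContinuousLinearMap.norm_id_le
  have hcomp : ContDiff ℝ n (g ∘ L) := hg.comp L.contDiff
  have hcomp' : ContDiff ℝ n fun ξ => (g ∘ L) (ξ - x₀) := hcomp.comp (contDiff_id.sub contDiff_const)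
  have hLapp : ∀ y, L y = c⁻¹ • y := fun y => by simp [hL]
  have e0 : (fun ξ => c⁻¹ • g (c⁻¹ • (ξ - x₀))) = c⁻¹ • fun ξ => (g ∘ L) (ξ - x₀) := by
    funext ξ; simp only [Pi.smul_apply, Function.comp_apply, hLapp]
  have e1 : iteratedFDeriv ℝ n (fun ξ => c⁻¹ • g (c⁻¹ • (ξ - x₀))) ξ =
      c⁻¹ • (iteratedFDeriv ℝ n g (L (ξ - x₀))).compContinuousLinearMap fun _ => L := by
    rw [e0, iteratedFDeriv_const_smul_apply hcomp'.contDiffAt, iteratedFDeriv_comp_sub,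
      L.iteratedFDeriv_comp_right hg _ le_rfl]
  have hLξ : L (ξ - x₀) = c⁻¹ • (ξ - x₀) := by simp [hL]
  rw [e1, hLξ, norm_smul, Real.norm_of_nonneg (inv_nonneg.2 hc.le), pow_succ, mul_comm (c⁻¹ ^ n), mul_assoc]
  refine mul_le_mul_of_nonneg_left ?_ (inv_nonneg.2 hc.le)
  refine (ContinuousMultilinearMap.norm_compContinuousLinearMap_le _ _).trans ?_
  rw [Finset.prod_const, Finset.card_univ, Fintype.card_fin, mul_comm]
  exact mul_le_mul_of_nonneg_right (pow_le_pow_left₀ (norm_nonneg _) hLn n) (norm_nonneg _)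

/-- **Uniform bound for the potential along the flow on the decay class**: for a velocity field
jointly smooth on `[0, T] × ℝ³` with `(1+|y|)|u(t,y)| ≤ C` for all `t ∈ [0,T]`,
`|Q[u(t)](0)| ≤ M` for all `t ∈ [0, T]` (near part: `Γ₀ ∈ L¹` against the source, bounded on the
compact `[0,T] × B̄₂`; far part: `exists_bound_farPotential_scale_decay`). [folklore] -/
theorem exists_bound_pressurePotential_decay {T : ℝ} (hT : 0 < T) {u : ℝ → ℝ³ → ℝ³}
    (hu : FluidPDE.IsSmoothSpaceTimeOn (Icc 0 T) u) {C : ℝ}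
    (hdec : ∀ t ∈ Icc 0 T, ∀ y, ‖u t y‖ ≤ C / (1 + ‖y‖)) :
    ∃ M, ∀ t ∈ Icc 0 T, |pressurePotential (u t) 0| ≤ M := by
  have hS := uniqueDiffOn_Icc hT
  obtain ⟨MG, hMG⟩ := (hu.pressureSource hS).exists_bound isCompact_Icc
    (isCompact_closedBall (0 : ℝ³) 2)
  set MG' := max MG 0 with hMG'
  obtain ⟨Kd, hKd0, hKd⟩ := exists_bound_farPotential_scale_decay
  refine ⟨MG' * (∫ z, |newtonNear (1 : ℝ) 2 z|) + Kd * C ^ 2, fun t ht => ?_⟩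
  -- near part
  have h1 : |nearPotential 1 2 (u t) 0| ≤ MG' * ∫ z, |newtonNear (1 : ℝ) 2 z| := by
    rw [nearPotential, ← Real.norm_eq_abs, ← integral_const_mul]
    refine norm_integral_le_of_norm_le ((integrable_newtonNear zero_le_one one_lt_two).abs.const_mul _)
      (Eventually.of_forall fun z => ?_)
    rw [Real.norm_eq_abs, abs_mul, mul_comm (MG')]
    by_cases hz : ‖z‖ ≤ 2
    · refine mul_le_mul_of_nonneg_left ?_ (abs_nonneg _)
      have := hMG t ht (0 - z) (by rw [mem_closedBall_zero_iff, zero_sub, norm_neg]; exact hz)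
      rw [Real.norm_eq_abs] at this
      exact this.trans (le_max_left _ _)
    · rw [newtonNear_eq_zero zero_le_one one_lt_two (not_le.1 hz).le, abs_zero, zero_mul, zero_mul]
  -- far part
  have h2 : |farPotential 1 2 (u t) 0| ≤ Kd * C ^ 2 := by
    have := hKd (u t) C (hu.contDiff_slice ht).continuous (hdec t ht) 1 le_rfl 0
    simpa using this
  rw [pressurePotential]
  calc |-nearPotential 1 2 (u t) 0 - farPotential 1 2 (u t) 0|
      ≤ |nearPotential 1 2 (u t) 0| + |farPotential 1 2 (u t) 0| := by
        rw [show -nearPotential 1 2 (u t) 0 - farPotential 1 2 (u t) 0 =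
          -(nearPotential 1 2 (u t) 0 + farPotential 1 2 (u t) 0) by ring, abs_neg]
        exact abs_add_le _ _
    _ ≤ _ := add_le_add h1 h2

/-- **Hölder on the unit ball**: `∫⁻_{B₁} |Q|^{3/2} ≤ (∫⁻_{B₁}|Q|²)^{3/4} |B₁|^{1/4}`. [folklore] -/
theorem lintegral_ball_rpow_three_halves_le {Q : ℝ³ → ℝ} (hQ : Continuous Q) :
    ∫⁻ x in ball (0 : ℝ³) 1, ‖Q x‖ₑ ^ (3 / 2 : ℝ) ≤
      (∫⁻ x in ball (0 : ℝ³) 1, ‖Q x‖ₑ ^ (2 : ℝ)) ^ (3 / 4 : ℝ) * (volume (ball (0 : ℝ³) 1)) ^ (1 / 4 : ℝ) := by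
  have hpq : (4 / 3 : ℝ).HolderConjugate 4 := by
    rw [Real.holderConjugate_iff]; norm_num
  have hfm : AEMeasurable (fun x => ‖Q x‖ₑ ^ (3 / 2 : ℝ)) (volume.restrict (ball (0 : ℝ³) 1)) :=
    (hQ.measurable.enorm.pow_const _).aemeasurable
  have hgm : AEMeasurable (fun _ : ℝ³ => (1 : ℝ≥0∞)) (volume.restrict (ball (0 : ℝ³) 1)) := aemeasurable_const
  have key := ENNReal.lintegral_mul_le_Lp_mul_Lq (volume.restrict (ball (0 : ℝ³) 1)) hpq hfm hgm
  have e0 : ∫⁻ x in ball (0 : ℝ³) 1, ‖Q x‖ₑ ^ (3 / 2 : ℝ) =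
      ∫⁻ a in ball (0 : ℝ³) 1, ((fun x : ℝ³ => ‖Q x‖ₑ ^ (3 / 2 : ℝ)) * fun _ : ℝ³ => (1 : ℝ≥0∞)) a := by
    refine lintegral_congr fun a => ?_
    simp only [Pi.mul_apply, mul_one]
  have e1 : ∫⁻ a in ball (0 : ℝ³) 1, (fun x => ‖Q x‖ₑ ^ (3 / 2 : ℝ)) a ^ (4 / 3 : ℝ) =
      ∫⁻ x in ball (0 : ℝ³) 1, ‖Q x‖ₑ ^ (2 : ℝ) := by
    refine lintegral_congr fun a => ?_
    dsimp only
    rw [← ENNReal.rpow_mul]; norm_num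
  have e2 : ∫⁻ a in ball (0 : ℝ³) 1, (fun _ : ℝ³ => (1 : ℝ≥0∞)) a ^ (4 : ℝ) = volume (ball (0 : ℝ³) 1) := by
    simp only [ENNReal.one_rpow, lintegral_const, Measure.restrict_apply MeasurableSet.univ, univ_inter, one_mul]
  have e3 : (1 : ℝ) / (4 / 3) = 3 / 4 := by norm_num
  rw [e0]
  refine key.trans (le_of_eq ?_)
  rw [e1, e2, e3]

/-- **Lemma 7.1, physical variables (plan (II-b)): derivative bounds of all orders for classical
Type I solutions, with constants depending on `C₀` only.** For every `n` and `C₀` there is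
`K = K(n, C₀)` such that every classical solution `(u, p)` of Navier–Stokes (`ν = 1`, `f = 0`) on
`(−∞, 0)` with `|u(x,t)| ≤ C₀/(|x| + √(−t))` obeys
`‖Dⁿₓu(t, ·)(x)‖ ≤ K · max{|x|, √(−t)}^{−(n+1)}` for all `t < 0`, `x`. Proof (the source's, with
the pressure route): zoom by `c = max{|x|, √(−t − δ)}/16`, `δ = −t/2048`, onto the unit cylinder
`Q((1,0),1)` below the point; there `|v| ≤ C₀` (footnote 22), the pressure is the potential
`Q[v(s̃)]` up to the gauge `h(s̃) = q(s̃,0) − Q[v(s̃)](0)` (`gradient_pressure_eq_of_typeI_vertex`,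
footnote 21 being the reason for working on `(−∞,0)`), whose cylinder mass is bounded by
`exists_local_pressure_mass_bound` (the zoomed slice is a near-singular profile with vertex on
the sphere of radius `16` or regular), and the quantitative bootstrap
`exists_forall_iteratedFDeriv_le_of_bounded` applies; unzoom. [cite: PineauVicol2026, Lemma 7.1 (proof, p. 24), footnotes 21–22] -/
theorem exists_forall_iteratedFDeriv_le_of_typeI (n : ℕ) (C₀ : ℝ) :
    ∃ K : ℝ, 0 ≤ K ∧ ∀ (u : ℝ → ℝ³ → ℝ³) (p : ℝ → ℝ³ → ℝ),
      FluidPDE.IsClassicalNSSolutionOn (Iio 0) 1 0 u p →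
      (∀ t ∈ Iio (0 : ℝ), ∀ x, ‖u t x‖ ≤ C₀ / (‖x‖ + Real.sqrt (-t))) →
      ∀ t ∈ Iio (0 : ℝ), ∀ x : ℝ³,
        ‖iteratedFDeriv ℝ n (u t) x‖ ≤ K * ((max ‖x‖ (Real.sqrt (-t)))⁻¹) ^ (n + 1) := by
  -- constants: the local pressure mass and the bootstrap
  obtain ⟨Ka, hKa0, hKa⟩ := exists_local_pressure_mass_bound
  set V₁ : ℝ≥0∞ := volume (ball (0 : ℝ³) 1) with hV₁
  have hV₁top : V₁ ≠ ⊤ := measure_ball_lt_top.ne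
  set P : ℝ≥0 := ((ENNReal.ofReal (Ka * C₀ ^ 4)) ^ (3 / 4 : ℝ) * V₁ ^ (1 / 4 : ℝ)).toNNReal with hP
  obtain ⟨Kc, hKc0, hKc⟩ := exists_forall_iteratedFDeriv_le_of_bounded n (max C₀ 0) P
  refine ⟨Kc * 17 ^ (n + 1), by positivity, fun u p hsol hI t ht x => ?_⟩
  have ht0 : t < 0 := ht
  by_cases hC₀ : C₀ < 0
  · -- vacuous: the bound at `x` forces `0 ≤ C₀`
    exfalso
    have := (norm_nonneg _).trans (hI t ht x)
    have hpos : 0 < ‖x‖ + Real.sqrt (-t) := by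
      have := Real.sqrt_pos.2 (neg_pos.2 ht0); positivity
    rw [le_div_iff₀ hpos, zero_mul] at this
    linarith
  push Not at hC₀
  have hmaxC : max C₀ 0 = C₀ := max_eq_left hC₀
  -- the zoom parameters
  set δ : ℝ := -t / 2048 with hδ
  have hδ0 : 0 < δ := by rw [hδ]; linarith
  have htδ : 0 < -t - δ := by rw [hδ]; linarith
  set ρ : ℝ := Real.sqrt (-t - δ) with hρ
  have hρ0 : 0 < ρ := Real.sqrt_pos.2 htδ
  have hρ2 : ρ ^ 2 = -t - δ := Real.sq_sqrt htδ.le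
  set m : ℝ := max ‖x‖ ρ with hm
  have hm0 : 0 < m := lt_max_of_lt_right hρ0
  set c : ℝ := m / 16 with hc
  have hc0 : 0 < c := by rw [hc]; positivity
  have hc16 : m = 16 * c := by rw [hc]; ring
  clear_value δ ρ m c
  -- `δ < c²/4` (so that the target point sits in the half cylinder)
  have hδc : δ < c ^ 2 / 4 := by
    have h1 : ρ ≤ m := by rw [hm]; exact le_max_right _ _
    have h2 : ρ ^ 2 ≤ m ^ 2 := pow_le_pow_left₀ hρ0.le h1 2
    rw [hc]; rw [hρ2] at h2; rw [hδ] at h2 ⊢; nlinarith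
  -- the zoomed solution with vertex `σ* = 1 + (−t−δ)/c²` and `y₀ = −x/c`
  set t₀ : ℝ := t + δ - c ^ 2 with ht₀
  have ht₀0 : t₀ < 0 := by rw [ht₀]; nlinarith
  set σ : ℝ := -t₀ / c ^ 2 with hσ
  have hc2 : 0 < c ^ 2 := by positivity
  have hσ1 : σ = 1 + (-t - δ) / c ^ 2 := by rw [hσ, ht₀]; field_simp; ring
  have hσgt : 1 < σ := by rw [hσ1]; have := div_pos htδ hc2; linarith
  set v : ℝ → ℝ³ → ℝ³ := c • stPull (c ^ 2) c t₀ x u with hv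
  set q : ℝ → ℝ³ → ℝ := c ^ 2 • stPull (c ^ 2) c t₀ x p with hq
  have hvsol : FluidPDE.IsClassicalNSSolutionOn (Iio σ) 1 0 v q := by
    have h := hsol.nsRescale_translate_zero hc0 t₀ x
    refine h.mono (fun r hr => ?_) (uniqueDiffOn_Iio σ)
    simp only [mem_preimage, mem_Iio] at hr ⊢
    rw [hσ, lt_div_iff₀ hc2] at hr
    linarith
  set y₀ : ℝ³ := -(c⁻¹ • x) with hy₀
  have hvapp : ∀ r ξ, v r ξ = c • u (t₀ + c ^ 2 * r) (x + c • ξ) := fun r ξ => rfl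
  clear_value v q t₀ σ y₀
  have hy₀n : ‖y₀‖ = ‖x‖ / c := by
    rw [hy₀, norm_neg, norm_smul, Real.norm_of_nonneg (inv_nonneg.2 hc0.le), div_eq_inv_mul]
  have hy₀le : ‖y₀‖ ≤ 16 := by
    rw [hy₀n, div_le_iff₀ hc0, ← hc16, hm]; exact le_max_left _ _
  -- the Type I profile of `v` with vertex `(σ, y₀)`
  have hprof : ∀ r ∈ Iio σ, ∀ ξ, ‖v r ξ‖ ≤ C₀ / (‖ξ - y₀‖ + Real.sqrt (σ - r)) := by
    intro r hr ξ
    have hr' : t₀ + c ^ 2 * r < 0 := by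
      simp only [mem_Iio] at hr
      rw [hσ, lt_div_iff₀ hc2] at hr; linarith
    have hb := hI _ hr' (x + c • ξ)
    have e1 : x + c • ξ = c • (ξ - y₀) := by
      rw [hy₀, sub_neg_eq_add, smul_add, smul_smul, mul_inv_cancel₀ hc0.ne', one_smul, add_comm]
    have e2 : -(t₀ + c ^ 2 * r) = c ^ 2 * (σ - r) := by rw [hσ]; field_simp; ring
    have e3 : Real.sqrt (-(t₀ + c ^ 2 * r)) = c * Real.sqrt (σ - r) := by
      rw [e2, Real.sqrt_mul (le_of_lt hc2), Real.sqrt_sq hc0.le]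
    have hnx : ‖x + c • ξ‖ = c * ‖ξ - y₀‖ := by rw [e1, norm_smul, Real.norm_of_nonneg hc0.le]
    have hden_eq : ‖x + c • ξ‖ + Real.sqrt (-(t₀ + c ^ 2 * r)) = c * (‖ξ - y₀‖ + Real.sqrt (σ - r)) := by
      rw [e3, hnx]; ring
    rw [hden_eq] at hb
    rw [hvapp, norm_smul, Real.norm_of_nonneg hc0.le]
    have hden : 0 < ‖ξ - y₀‖ + Real.sqrt (σ - r) := by
      have := Real.sqrt_pos.2 (by linarith [mem_Iio.1 hr] : (0:ℝ) < σ - r); positivity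
    calc c * ‖u (t₀ + c ^ 2 * r) (x + c • ξ)‖ ≤ c * (C₀ / (c * (‖ξ - y₀‖ + Real.sqrt (σ - r)))) :=
          mul_le_mul_of_nonneg_left hb hc0.le
      _ = C₀ / (‖ξ - y₀‖ + Real.sqrt (σ - r)) := by field_simp
  -- the two regimes: vertex on the sphere of radius `16`, or `σ - r ≥ 256`
  have h16 : ∀ r, r < 1 → 16 ≤ ‖y₀‖ + Real.sqrt (σ - r) := by
    intro r hr
    have hsq0 : 0 ≤ Real.sqrt (σ - r) := Real.sqrt_nonneg _
    by_cases hcase : ρ ≤ ‖x‖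
    · have hm' : m = ‖x‖ := by rw [hm]; exact max_eq_left hcase
      have hy16 : ‖y₀‖ = 16 := by
        rw [hy₀n, div_eq_iff hc0.ne', ← hc16, hm']
      linarith
    · have hm' : m = ρ := by rw [hm]; exact max_eq_right (le_of_lt (not_le.1 hcase))
      have hρc : ρ = 16 * c := by rw [← hc16, hm']
      have hσr : (16 : ℝ) ^ 2 ≤ σ - r := by
        have : σ - 1 = ρ ^ 2 / c ^ 2 := by rw [hσ1, hρ2]; ring
        have h256 : ρ ^ 2 / c ^ 2 = 16 ^ 2 := by rw [hρc]; field_simp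
        linarith
      have h16' : (16 : ℝ) ≤ Real.sqrt (σ - r) := by
        rw [show (16 : ℝ) = Real.sqrt (16 ^ 2) by rw [Real.sqrt_sq (by norm_num)]]
        exact Real.sqrt_le_sqrt hσr
      linarith [norm_nonneg y₀]
  -- denominators on the unit cylinder below `(1, 0)`: `≥ 15`
  have hD : ∀ r, r < 1 → ∀ ξ : ℝ³, ‖ξ‖ ≤ 1 → 15 ≤ ‖ξ - y₀‖ + Real.sqrt (σ - r) := by
    intro r hr ξ hξ
    have h1 : ‖y₀‖ ≤ ‖ξ‖ + ‖ξ - y₀‖ := by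
      have := norm_sub_le ξ (ξ - y₀); rw [sub_sub_cancel] at this; linarith
    linarith [h16 r hr]
  -- (a) the region predicate on the unit cylinder below `(1, 0)`
  set z₁ : ℝ × ℝ³ := ((1 : ℝ), (0 : ℝ³)) with hz₁
  have hcyl_sub : parabolicCylinder 1 z₁ ⊆ Iio σ ×ˢ (univ : Set ℝ³) := by
    intro w hw
    rw [mem_parabolicCylinder] at hw
    refine mk_mem_prod ?_ (mem_univ _)
    simp only [mem_Iio]
    have : w.1 < 1 := by have := hw.1.2; simpa [hz₁] using this
    linarith
  have hreg : IsClassicalNSSolutionOnRegion (parabolicCylinder 1 z₁) 1 0 v q :=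
    hvsol.onRegion.mono_of_isOpen hcyl_sub (isOpen_parabolicCylinder 1 z₁)
  -- (b) smooth slices
  have hsl : ∀ w ∈ parabolicCylinder 1 z₁, ContDiff ℝ n (v w.1) := fun w hw =>
    (hvsol.contDiff_velocity (mem_prod.1 (hcyl_sub hw)).1).of_le (by exact_mod_cast le_top)
  -- (c) the velocity bound on the cylinder
  have hbd : ∀ w ∈ parabolicCylinder 1 z₁, ‖v w.1 w.2‖ ≤ max C₀ 0 / 1 := by
    intro w hw
    rw [hmaxC, div_one]
    have hw' := mem_parabolicCylinder.1 hw
    have hw1 : w.1 < 1 := by have := hw'.1.2; simpa [hz₁] using this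
    have hw2 : ‖w.2‖ ≤ 1 := by
      have : dist w.2 z₁.2 < 1 := hw'.2
      simp only [hz₁, dist_zero_right] at this; exact this.le
    have hwσ : w.1 ∈ Iio σ := by simp only [mem_Iio]; linarith
    have h15 := hD w.1 hw1 w.2 hw2
    calc ‖v w.1 w.2‖ ≤ C₀ / (‖w.2 - y₀‖ + Real.sqrt (σ - w.1)) := hprof w.1 hwσ w.2
      _ ≤ C₀ / 1 := div_le_div_of_nonneg_left hC₀ one_pos (by linarith)
      _ = C₀ := div_one _
  -- the decay class on `[0, 1]` (regular scale `s₀ = √(σ − 1)`), joint smoothness there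
  have hI01 : Icc (0 : ℝ) 1 ⊆ Iio σ := fun r hr => by simp only [mem_Iio]; linarith [hr.2]
  have hvsm : FluidPDE.IsSmoothSpaceTimeOn (Icc (0 : ℝ) 1) v := hvsol.smooth_velocity.mono hI01
  set s₀ : ℝ := Real.sqrt (σ - 1) with hs₀
  have hs₀0 : 0 < s₀ := Real.sqrt_pos.2 (by linarith)
  have hprof01 : ∀ r ∈ Icc (0 : ℝ) 1, ∀ ξ, ‖v r ξ‖ ≤ C₀ / (‖ξ - y₀‖ + s₀) := by
    intro r hr ξ
    have hsq : s₀ ≤ Real.sqrt (σ - r) := Real.sqrt_le_sqrt (by linarith [hr.2])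
    exact (hprof r (hI01 hr) ξ).trans (div_le_div_of_nonneg_left hC₀ (by positivity) (by linarith))
  set Cd : ℝ := C₀ * (1 + ‖y₀‖ + s₀) / min s₀ 1 with hCd
  have hdec01 : ∀ r ∈ Icc (0 : ℝ) 1, ∀ ξ, ‖v r ξ‖ ≤ Cd / (1 + ‖ξ‖) := fun r hr ξ =>
    decay_of_profile hs₀0 (hprof01 r hr) ξ
  -- (d) the gauge `h(r) = q(πr, 0) − Q[v(πr)](0)` and its local integrability
  set hfun : ℝ → ℝ := fun r => q (max 0 (min r 1)) 0 - pressurePotential (v (max 0 (min r 1))) 0 with hhfun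
  have hq_cont : ContinuousOn (uncurry q) (Icc (0 : ℝ) 1 ×ˢ univ) :=
    (hvsol.smooth_pressure.mono hI01).continuousOn
  have hq0c : Continuous fun r : ℝ => q (max 0 (min r 1)) 0 := by
    have h := continuous_clamp_comp zero_le_one (F := uncurry q) (Y := ℝ³) hq_cont continuous_const (g := fun _ => (0 : ℝ³))
    exact h.comp (continuous_id.prodMk continuous_const (f := fun r : ℝ => r) (g := fun _ => (0 : ℝ³)))
  have hmeasQ : Measurable fun r => pressurePotential (v (max 0 (min r 1))) 0 :=
    measurable_pressurePotential_clamp one_pos hvsm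
  have hmeas : Measurable hfun := hq0c.measurable.sub hmeasQ
  obtain ⟨MQ, hMQ⟩ := exists_bound_pressurePotential_decay one_pos hvsm hdec01
  obtain ⟨Mq, hMq⟩ : ∃ Mq, ∀ r ∈ Icc (0 : ℝ) 1, |q r 0| ≤ Mq := by
    have hc' : ContinuousOn (fun r : ℝ => q r 0) (Icc 0 1) :=
      hq_cont.comp (continuous_id.prodMk continuous_const).continuousOn fun r hr => mk_mem_prod hr (mem_univ _)
    obtain ⟨M, hM⟩ := isCompact_Icc.exists_bound_of_continuousOn hc'
    exact ⟨M, fun r hr => by have := hM r hr; rwa [Real.norm_eq_abs] at this⟩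
  have hbound : ∀ r, |hfun r| ≤ Mq + MQ := by
    intro r
    have hπ : max 0 (min r 1) ∈ Icc (0 : ℝ) 1 := clamp_mem zero_le_one r
    calc |hfun r| ≤ |q (max 0 (min r 1)) 0| + |pressurePotential (v (max 0 (min r 1))) 0| := abs_sub _ _
      _ ≤ Mq + MQ := add_le_add (hMq _ hπ) (hMQ _ hπ)
  have hcyl_eq : parabolicCylinder 1 z₁ = Ioo (0 : ℝ) 1 ×ˢ ball (0 : ℝ³) 1 := by
    rw [hz₁, parabolicCylinder]; norm_num
  have hcyl_fin : volume (parabolicCylinder 1 z₁) < ⊤ := by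
    rw [hcyl_eq, Measure.volume_eq_prod, Measure.prod_prod]
    exact ENNReal.mul_lt_top measure_Ioo_lt_top measure_ball_lt_top
  have hLI : LocallyIntegrableOn (fun w : ℝ × ℝ³ => hfun w.1) (parabolicCylinder 1 z₁) volume := by
    refine IntegrableOn.locallyIntegrableOn ?_
    refine Integrable.mono' (integrableOn_const hcyl_fin.ne (C := Mq + MQ)) ?_ ?_
    · exact (hmeas.comp measurable_fst).aestronglyMeasurable
    · exact Eventually.of_forall fun w => by rw [Real.norm_eq_abs]; exact hbound w.1
  -- (e) the pressure is the potential up to the gauge, on the cylinder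
  have hident : ∀ r ∈ Ioo (0 : ℝ) 1, ∀ ξ, q r ξ - hfun r = pressurePotential (v r) ξ := by
    intro r hr ξ
    have hrI : r ∈ Icc (0 : ℝ) 1 := Ioo_subset_Icc_self hr
    have hπ : max 0 (min r 1) = r := clamp_eq hrI
    have hrσ : r < σ := by linarith [hr.2]
    -- `∇(q r − Q[v r]) = 0`, hence constant
    have hq1 : ContDiff ℝ 1 (q r) := contDiff_infty.1 (hvsol.contDiff_pressure (mem_Iio.2 hrσ)) 1
    have hv4 : ContDiff ℝ 4 (v r) := contDiff_infty.1 (hvsol.contDiff_velocity (mem_Iio.2 hrσ)) 4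
    have hQ2 : ContDiff ℝ 2 (pressurePotential (v r)) := contDiff_pressurePotential_decay hv4 (hdec01 r hrI)
    have hdiff : Differentiable ℝ fun ξ => q r ξ - pressurePotential (v r) ξ :=
      (hq1.differentiable one_ne_zero).sub (hQ2.differentiable (by norm_num))
    have hzero : ∀ ξ, fderiv ℝ (fun ξ => q r ξ - pressurePotential (v r) ξ) ξ = 0 := by
      intro ξ
      have hg := gradient_pressure_eq_of_typeI_vertex hvsol hprof hrσ ξ
      rw [gradient, gradient] at hg
      have hfd : fderiv ℝ (q r) ξ = fderiv ℝ (pressurePotential (v r)) ξ :=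
        (InnerProductSpace.toDual ℝ ℝ³).symm.injective hg
      have ef : (fun ξ => q r ξ - pressurePotential (v r) ξ) = q r - pressurePotential (v r) := rfl
      rw [ef, fderiv_sub ((hq1.differentiable one_ne_zero) ξ) ((hQ2.differentiable (by norm_num)) ξ), hfd, sub_self]
    have hconst := is_const_of_fderiv_eq_zero hdiff hzero ξ 0
    rw [hhfun]; dsimp only; rw [hπ]
    linarith
  -- (f) the cylinder mass of the gauged pressure
  have hP_eq : (P : ℝ≥0∞) = (ENNReal.ofReal (Ka * C₀ ^ 4)) ^ (3 / 4 : ℝ) * V₁ ^ (1 / 4 : ℝ) := by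
    rw [hP, ENNReal.coe_toNNReal]
    exact ENNReal.mul_ne_top (ENNReal.rpow_ne_top_of_nonneg (by norm_num) ENNReal.ofReal_ne_top)
      (ENNReal.rpow_ne_top_of_nonneg (by norm_num) hV₁top)
  have hslice : ∀ r ∈ Ioo (0 : ℝ) 1,
      ∫⁻ ξ in ball (0 : ℝ³) 1, ‖q r ξ - hfun r‖ₑ ^ (3 / 2 : ℝ) ≤ (P : ℝ≥0∞) := by
    intro r hr
    have hrI : r ∈ Icc (0 : ℝ) 1 := Ioo_subset_Icc_self hr
    have hrσ : r < σ := by linarith [hr.2]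
    have hvinf : ContDiff ℝ ∞ (v r) := hvsol.contDiff_velocity (mem_Iio.2 hrσ)
    have hv4 : ContDiff ℝ 4 (v r) := contDiff_infty.1 hvinf 4
    have hQc : Continuous (pressurePotential (v r)) := (contDiff_pressurePotential_decay hv4 (hdec01 r hrI)).continuous
    -- the profile hypotheses of the local mass bound at time `r`
    have hsr0 : 0 < Real.sqrt (σ - r) := Real.sqrt_pos.2 (by linarith)
    obtain ⟨hQi, hQmass⟩ := hKa (v r) C₀ (Real.sqrt (σ - r)) y₀ hvinf hsr0 hy₀le (h16 r hr.2)
      (hprof r (mem_Iio.2 hrσ))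
    -- rewrite the integrand through the identification
    have e1 : ∀ ξ, ‖q r ξ - hfun r‖ₑ ^ (3 / 2 : ℝ) = ‖pressurePotential (v r) ξ‖ₑ ^ (3 / 2 : ℝ) := fun ξ => by
      rw [hident r hr ξ]
    simp only [e1]
    refine (lintegral_ball_rpow_three_halves_le hQc).trans ?_
    rw [hP_eq]
    gcongr
    -- `∫⁻_{B₁} |Q|² ≤ Ka C₀⁴`
    have e2 : ∀ ξ, ‖pressurePotential (v r) ξ‖ₑ ^ (2 : ℝ) = ENNReal.ofReal (|pressurePotential (v r) ξ| ^ 2) := by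
      intro ξ
      rw [Real.enorm_eq_ofReal_abs, show (2 : ℝ) = ((2 : ℕ) : ℝ) by norm_num, ENNReal.rpow_natCast,
        ENNReal.ofReal_pow (abs_nonneg _)]
    simp only [e2]
    have hQi0 : IntegrableOn (fun ξ => |pressurePotential (v r) ξ| ^ 2) (closedBall (0 : ℝ³) 1) := hQi
    have hQi' : IntegrableOn (fun ξ => |pressurePotential (v r) ξ| ^ 2) (ball (0 : ℝ³) 1) :=
      hQi0.mono_set ball_subset_closedBall
    rw [← ofReal_integral_eq_lintegral_ofReal hQi' (Eventually.of_forall fun ξ => by positivity)]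
    refine ENNReal.ofReal_le_ofReal ((setIntegral_mono_set hQi0 (Eventually.of_forall fun ξ => by positivity)
      ball_subset_closedBall.eventuallyLE).trans hQmass)
  have hmass : ∫⁻ w in parabolicCylinder 1 z₁, ‖q w.1 w.2 - hfun w.1‖ₑ ^ (3 / 2 : ℝ) ≤
      ENNReal.ofReal ((1 : ℝ) ^ 2) * P := by
    rw [one_pow, ENNReal.ofReal_one, one_mul, hcyl_eq, Measure.volume_eq_prod, ← Measure.prod_restrict]
    refine (lintegral_prod_le _).trans ?_
    have hae : ∀ᵐ r ∂(volume.restrict (Ioo (0 : ℝ) 1)),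
        ∫⁻ ξ in ball (0 : ℝ³) 1, ‖q (r, ξ).1 (r, ξ).2 - hfun (r, ξ).1‖ₑ ^ (3 / 2 : ℝ) ≤ (P : ℝ≥0∞) := by
      filter_upwards [ae_restrict_mem measurableSet_Ioo] with r hr
      exact hslice r hr
    refine (lintegral_mono_ae hae).trans ?_
    rw [lintegral_const, Measure.restrict_apply MeasurableSet.univ, univ_inter, Real.volume_Ioo]
    norm_num
  -- (g) the bootstrap on the unit cylinder
  set w₁ : ℝ × ℝ³ := (1 - δ / c ^ 2, (0 : ℝ³)) with hw₁
  have hw₁mem : w₁ ∈ parabolicCylinder (1 / 2) z₁ := by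
    rw [mem_parabolicCylinder, hw₁, hz₁]
    have hq' : δ / c ^ 2 < 1 / 4 := by rw [div_lt_iff₀ hc2]; linarith
    have hq0 : 0 < δ / c ^ 2 := div_pos hδ0 hc2
    refine ⟨⟨?_, ?_⟩, ?_⟩
    · show (1 : ℝ) - (1 / 2) ^ 2 < 1 - δ / c ^ 2
      linarith
    · show 1 - δ / c ^ 2 < (1 : ℝ)
      linarith
    · show dist (0 : ℝ³) 0 < 1 / 2
      simp
  have hKv := hKc v q hfun z₁ 1 one_pos hreg hsl hbd hLI hmass w₁ hw₁mem
  rw [one_pow, div_one] at hKv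
  -- (h) unzoom: `u t = c⁻¹ v(w₁.1, c⁻¹(· − x))`
  have ht_eq : t₀ + c ^ 2 * w₁.1 = t := by
    simp only [hw₁, ht₀]; field_simp; ring
  have hslice_eq : u t = fun ξ => c⁻¹ • (v w₁.1) (c⁻¹ • (ξ - x)) := by
    funext ξ
    rw [hvapp, ht_eq, smul_smul, inv_mul_cancel₀ hc0.ne', one_smul, smul_smul, mul_inv_cancel₀ hc0.ne',
      one_smul, add_sub_cancel]
  have hvw : ContDiff ℝ n (v w₁.1) := by
    have : w₁.1 < σ := by
      have : w₁.1 < 1 := by simp only [hw₁]; linarith [div_pos hδ0 hc2]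
      linarith
    exact (hvsol.contDiff_velocity (mem_Iio.2 this)).of_le (by exact_mod_cast le_top)
  have hun := norm_iteratedFDeriv_unzoom_le hvw hc0 x x
  rw [← hslice_eq, sub_self, smul_zero] at hun
  have hw₁2 : w₁.2 = 0 := rfl
  rw [hw₁2] at hKv
  -- (i) `c⁻¹ ≤ 17 / max{|x|, √(−t)}`
  have hst : 0 < Real.sqrt (-t) := Real.sqrt_pos.2 (neg_pos.2 ht0)
  have hM0 : 0 < max ‖x‖ (Real.sqrt (-t)) := lt_max_of_lt_right hst
  have hcinv : c⁻¹ ≤ 17 * (max ‖x‖ (Real.sqrt (-t)))⁻¹ := by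
    -- `ρ ≥ (16/17) √(−t)` since `2047/2048 ≥ (16/17)²`
    have hρge : 16 / 17 * Real.sqrt (-t) ≤ ρ := by
      have h1 : (16 / 17 : ℝ) * Real.sqrt (-t) = Real.sqrt ((16 / 17) ^ 2 * (-t)) := by
        rw [Real.sqrt_mul (by norm_num), Real.sqrt_sq (by norm_num)]
      have h2 : (16 / 17 : ℝ) ^ 2 * (-t) ≤ -t - δ := by rw [hδ]; linarith [neg_pos.2 ht0]
      rw [h1, hρ]
      exact Real.sqrt_le_sqrt h2
    have hmge : 16 / 17 * max ‖x‖ (Real.sqrt (-t)) ≤ m := by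
      rcases le_total ‖x‖ (Real.sqrt (-t)) with hle | hle
      · rw [max_eq_right hle]; exact hρge.trans (by rw [hm]; exact le_max_right _ _)
      · rw [max_eq_left hle]
        have h3 : 16 / 17 * ‖x‖ ≤ ‖x‖ := by linarith [norm_nonneg x]
        exact h3.trans (by rw [hm]; exact le_max_left _ _)
    rw [hc, inv_div, div_le_iff₀ hm0, mul_assoc]
    rw [show 17 * ((max ‖x‖ (Real.sqrt (-t)))⁻¹ * m) = 17 * m / max ‖x‖ (Real.sqrt (-t)) by ring,
      le_div_iff₀ hM0]
    linarith
  have hcinv0 : 0 ≤ c⁻¹ := inv_nonneg.2 hc0.le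
  calc ‖iteratedFDeriv ℝ n (u t) x‖ ≤ c⁻¹ ^ (n + 1) * ‖iteratedFDeriv ℝ n (v w₁.1) 0‖ := hun
    _ ≤ c⁻¹ ^ (n + 1) * Kc := mul_le_mul_of_nonneg_left hKv (by positivity)
    _ ≤ (17 * (max ‖x‖ (Real.sqrt (-t)))⁻¹) ^ (n + 1) * Kc :=
        mul_le_mul_of_nonneg_right (pow_le_pow_left₀ hcinv0 hcinv _) hKc0
    _ = Kc * 17 ^ (n + 1) * (max ‖x‖ (Real.sqrt (-t)))⁻¹ ^ (n + 1) := by rw [mul_pow]; ring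

end TypeIRegularity

end PineauVicol2026

end Literature.Analysis.FluidPDE
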